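import Summits.Ventures.Crystal3D.Theorems.StickyWulffConstantNoReconstructionGainSampleDeficit
import Summits.Ventures.Crystal3D.StickySpheres.FccDeficiencyIdentity
import Summits.Ventures.Crystal3D.StickySpheres.LineConvexBoundaryPairs
import Mathlib.Analysis.Convex.Basic
import HarnessLib

/-!
# The lattice rung of the adhesion atom: no lattice continuation of a convex sample gains

HONEST FRAMING. Part of the venture `Summits/Ventures/Crystal3D` (cell `crystal3d-full`), helper
for the crux `NoReconstructionGain` (stmt-Ventures-19144, `route-Ventures-StickyWulffConstant`,
line `adhesion`).  ON-LATTICE only.  With `X ⊇ P`, `Q = X \ P` the deficiency splits as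
`D(X) = D(P) + D(Q) − #cross(P,Q)` (`contactDeficiency_sdiff_split`), so the crux =
`stub_sampleDeficit` (landed) + the ATOM `#cross(P,Q) ≤ D(Q) + Cρ` for an arbitrary unit packing
`Q` outside the slab sample `P`.  Here: the atom's LATTICE RUNG with constant `0` —
`contactDeficiency_le_of_convex_sample`: `X ⊆ Λ₀ = fccStacking 1 √(2/3)` finite, `P = Λ₀ ∩ K ⊆ X`,
`K` CONVEX ⇒ `D(P) ≤ D(X)` (each of the six `⟨110⟩` line classes meets `P` in intervals, so `D(P)`
is EXACTLY the number of bond lines meeting `P` — `fcc_deficiency_eq_half_boundaryPairs`,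
`card_boundaryPairs_eq_two_mul_sum_card_dropCoord` — and `D(X)` is at least the number meeting
`X ⊇ P`, `numContacts_add_sum_card_dropCoord_le`); `cross_le_contactDeficiency_of_convex_sample`:
`#cross(P, X \ P) ≤ D(X \ P)` (tight for complete layers); `convex_slabSampleRegion`; and
`latticeNoGain` — **`LatticeNoGain` at EVERY normal** (the cell's P1-SPEC-A, HOME/eng/MEMO-3.md
ADDENDUM K; `C = 60 √2 π` uniform in `ν`): every finite `X ⊆ Λ₀` containing the slab sample has
`D(X) ≥ 2 φ(ν) π ρ² − C ρ`.
WHAT THIS IS NOT: the atom for OFF-LATTICE `Q` (the crux proper) is untouched; rung F-C1 not moved.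
-/

noncomputable section

namespace Summit.Ventures.Crystal3D.Theorems

open Summit.Ventures.Crystal3D Finset Matrix
open Literature.Probability.LatticeModels (Site dropCoord mem_dropCoord_iff boundaryPairs)
open Literature.MathematicalPhysics.StatisticalMechanics (barlowPos barlowStacking fccStacking
  constHagg haggLabel_const isHaggSeq_const barlowPos_mem orderedContacts contactDeficiency
  le_dist_of_mem_barlowStacking_ideal)
open scoped InnerProductSpace

/-! ## The deficiency splits over `P ⊆ X` up to the cross-contact term -/

/-- Ordered contacts as a double sum of indicators. -/
theorem orderedContacts_eq_sum_sum (X : Finset (EuclideanSpace ℝ (Fin 3))) :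
    (orderedContacts X : ℝ) =
      ∑ p ∈ X, ∑ q ∈ X, (if dist p q = 1 then (1 : ℝ) else 0) := by
  classical
  unfold orderedContacts
  rw [Finset.card_filter, Nat.cast_sum, Finset.sum_product]
  refine Finset.sum_congr rfl fun p _ => Finset.sum_congr rfl fun q _ => ?_
  split_ifs <;> simp

/-- The cross-contact count as a double sum of indicators. -/
theorem card_crossContacts_eq_sum_sum (P Q : Finset (EuclideanSpace ℝ (Fin 3))) :
    ((((P ×ˢ Q).filter fun pq => dist pq.1 pq.2 = 1).card : ℕ) : ℝ) =
      ∑ p ∈ P, ∑ q ∈ Q, (if dist p q = 1 then (1 : ℝ) else 0) := by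
  classical
  rw [Finset.card_filter, Nat.cast_sum, Finset.sum_product]
  refine Finset.sum_congr rfl fun p _ => Finset.sum_congr rfl fun q _ => ?_
  split_ifs <;> simp

/-- **Splitting the deficiency.** For `P ⊆ X`:
`D(X) = D(P) + D(X \ P) − #{(p, q) ∈ P × (X \ P) : dist p q = 1}`. -/
theorem contactDeficiency_sdiff_split {X P : Finset (EuclideanSpace ℝ (Fin 3))} (hPX : P ⊆ X) :
    contactDeficiency X = contactDeficiency P + contactDeficiency (X \ P) -
      ((((P ×ˢ (X \ P)).filter fun pq => dist pq.1 pq.2 = 1).card : ℕ) : ℝ) := by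
  classical
  set Q := X \ P with hQ
  have hXPQ : X = P ∪ Q := by rw [hQ, Finset.union_sdiff_of_subset hPX]
  have hdisj : Disjoint P Q := by rw [hQ]; exact Finset.disjoint_sdiff
  have hcard : (X.card : ℝ) = P.card + Q.card := by
    rw [hXPQ, Finset.card_union_of_disjoint hdisj]; push_cast; ring
  set f : EuclideanSpace ℝ (Fin 3) → EuclideanSpace ℝ (Fin 3) → ℝ :=
    fun p q => if dist p q = 1 then (1 : ℝ) else 0 with hf
  have hsymm : ∀ p q, f p q = f q p := by
    intro p q; simp only [hf, dist_comm]
  have hX : (orderedContacts X : ℝ) = ∑ p ∈ X, ∑ q ∈ X, f p q := orderedContacts_eq_sum_sum X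
  have hP : (orderedContacts P : ℝ) = ∑ p ∈ P, ∑ q ∈ P, f p q := orderedContacts_eq_sum_sum P
  have hQ' : (orderedContacts Q : ℝ) = ∑ p ∈ Q, ∑ q ∈ Q, f p q := orderedContacts_eq_sum_sum Q
  have hC : ((((P ×ˢ Q).filter fun pq => dist pq.1 pq.2 = 1).card : ℕ) : ℝ) =
      ∑ p ∈ P, ∑ q ∈ Q, f p q := card_crossContacts_eq_sum_sum P Q
  have hsplit : ∑ p ∈ X, ∑ q ∈ X, f p q =
      (∑ p ∈ P, ∑ q ∈ P, f p q) + (∑ p ∈ P, ∑ q ∈ Q, f p q) +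
        ((∑ p ∈ Q, ∑ q ∈ P, f p q) + (∑ p ∈ Q, ∑ q ∈ Q, f p q)) := by
    rw [hXPQ, Finset.sum_union hdisj]
    congr 1
    · rw [← Finset.sum_add_distrib]
      exact Finset.sum_congr rfl fun p _ => Finset.sum_union hdisj
    · rw [← Finset.sum_add_distrib]
      exact Finset.sum_congr rfl fun p _ => Finset.sum_union hdisj
  have hswap : ∑ p ∈ Q, ∑ q ∈ P, f p q = ∑ p ∈ P, ∑ q ∈ Q, f p q := by
    rw [Finset.sum_comm]
    exact Finset.sum_congr rfl fun p _ => Finset.sum_congr rfl fun q _ => hsymm q p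
  unfold contactDeficiency
  rw [hX, hP, hQ', hC, hcard, hsplit, hswap]
  ring

/-- A finite subset `S` of the model fcc packing, enumerated injectively with integer coordinates:
`S = range x`, `x i = barlowPos 1 √(2/3) constHagg (kf i) (pf i) (qf i)`, and `x` is a unit
packing. -/
theorem exists_enum_fcc (S : Finset (EuclideanSpace ℝ (Fin 3)))
    (hS : (↑S : Set (EuclideanSpace ℝ (Fin 3))) ⊆ fccStacking 1 (Real.sqrt (2 / 3))) :
    ∃ (N : ℕ) (x : Fin N → EuclideanSpace ℝ (Fin 3)) (kf pf qf : Fin N → ℤ),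
      Function.Injective x ∧ univ.image x = S ∧
      (∀ i, x i = barlowPos 1 (Real.sqrt (2 / 3)) constHagg (kf i) (pf i) (qf i)) ∧
      IsUnitPacking x := by
  classical
  set N : ℕ := S.card
  set x : Fin N → EuclideanSpace ℝ (Fin 3) := fun i => ((S.equivFin.symm i : S) : _) with hxdef
  have hxinj : Function.Injective x := fun i j h => S.equivFin.symm.injective (Subtype.ext h)
  have himage : univ.image x = S := by
    ext p
    simp only [mem_image, mem_univ, true_and]
    exact ⟨fun ⟨i, hi⟩ => hi ▸ (S.equivFin.symm i).2, fun hp => ⟨S.equivFin ⟨p, hp⟩, by simp [hxdef]⟩⟩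
  have hmem : ∀ i, x i ∈ fccStacking 1 (Real.sqrt (2 / 3)) := fun i =>
    hS (mem_coe.2 (S.equivFin.symm i).2)
  have hcoord : ∀ i, ∃ k p q : ℤ, x i = barlowPos 1 (Real.sqrt (2 / 3)) constHagg k p q :=
    fun i => hmem i
  choose kf pf qf hc using hcoord
  have hpack : IsUnitPacking x := fun i j hij =>
    le_dist_of_mem_barlowStacking_ideal isHaggSeq_const one_pos fcc_height_sq (hmem i) (hmem j)
      (fun h => hij (hxinj h))
  exact ⟨N, x, kf, pf, qf, hxinj, himage, hc, hpack⟩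

/-! ## The two charts as frames: positions are ℤ-affine along each chart direction -/

/-- A frame map `c ↦ Σ_l c_l • E_l` moves by `(z_d − s_d) • E_d` between two sites with the same
`d`-shadow. -/
theorem frame_sub_of_removeNth_eq (E : Fin 3 → EuclideanSpace ℝ (Fin 3)) (d : Fin 3)
    (s z : Site 3) (h : Fin.removeNth d z = Fin.removeNth d s) :
    (∑ l, ((z l : ℤ) : ℝ) • E l) = (∑ l, ((s l : ℤ) : ℝ) • E l) + (((z d - s d : ℤ) : ℝ)) • E d := by
  have hl : ∀ l, l ≠ d → z l = s l := by
    intro l hl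
    obtain ⟨j, hj⟩ := Fin.exists_succAbove_eq hl
    have := congrFun h j
    simp only [Fin.removeNth] at this
    rwa [hj] at this
  have hdiff : (∑ l, ((z l : ℤ) : ℝ) • E l) - (∑ l, ((s l : ℤ) : ℝ) • E l) =
      (((z d - s d : ℤ) : ℝ)) • E d := by
    rw [← Finset.sum_sub_distrib]
    rw [Finset.sum_eq_single d]
    · rw [← sub_smul]; push_cast; rfl
    · intro l _ hld
      rw [hl l hld, sub_self]
    · intro hd; exact absurd (mem_univ d) hd
  rw [← hdiff]; abel

/-- **`D(P) ≤ D(X)` for a convex sample inside a lattice cluster.**  `Λ₀ = fccStacking 1 √(2/3)`;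
`X ⊆ Λ₀` finite, `P ⊆ X`, and `P = Λ₀ ∩ K` for a convex `K`.  Then
`contactDeficiency P ≤ contactDeficiency X`. -/
theorem contactDeficiency_le_of_convex_sample (X P : Finset (EuclideanSpace ℝ (Fin 3)))
    (K : Set (EuclideanSpace ℝ (Fin 3))) (hK : Convex ℝ K)
    (hX : (↑X : Set (EuclideanSpace ℝ (Fin 3))) ⊆ fccStacking 1 (Real.sqrt (2 / 3)))
    (hPX : P ⊆ X) (hP : ∀ p, p ∈ P ↔ (p ∈ fccStacking 1 (Real.sqrt (2 / 3)) ∧ p ∈ K)) :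
    contactDeficiency P ≤ contactDeficiency X := by
  classical
  -- enumerate `X` and `P`
  obtain ⟨N, x, kf, pf, qf, hxinj, hxim, hcx, hxpack⟩ := exists_enum_fcc X hX
  have hPΛ : (↑P : Set (EuclideanSpace ℝ (Fin 3))) ⊆ fccStacking 1 (Real.sqrt (2 / 3)) :=
    fun p hp => ((hP p).1 (mem_coe.1 hp)).1
  obtain ⟨M, y, kg, pg, qg, hyinj, hyim, hcy, hypack⟩ := exists_enum_fcc P hPΛ
  -- the chart images
  set a₁ : Fin N → Site 3 := fun i => ![pf i, qf i + kf i, -kf i] with ha₁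
  set a₂ : Fin N → Site 3 := fun i => ![kf i + pf i + qf i, pf i + qf i, -qf i] with ha₂
  set b₁ : Fin M → Site 3 := fun i => ![pg i, qg i + kg i, -kg i] with hb₁
  set b₂ : Fin M → Site 3 := fun i => ![kg i + pg i + qg i, pg i + qg i, -qg i] with hb₂
  -- `D(X) ≥` lines meeting `X`
  have hDX : contactDeficiency X = 6 * (N : ℝ) - (numContacts x : ℝ) := by
    rw [← hxim, contactDeficiency_image_eq x hxinj]
  have hshadow := numContacts_add_sum_card_dropCoord_le x hxpack kf pf qf hcx
  have hshadow' : (numContacts x : ℝ) + ((∑ d : Fin 3, (dropCoord d (univ.image a₁)).card : ℕ) : ℝ)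
      + ((∑ d : Fin 3, (dropCoord d (univ.image a₂)).card : ℕ) : ℝ) ≤ 6 * (N : ℝ) := by
    exact_mod_cast hshadow
  -- `D(P) =` lines meeting `P`
  have hDP : contactDeficiency P = 6 * (M : ℝ) - (numContacts y : ℝ) := by
    rw [← hyim, contactDeficiency_image_eq y hyinj]
  have hhalf := fcc_deficiency_eq_half_boundaryPairs y hypack kg pg qg hcy
  -- the frames of the two charts
  set u : EuclideanSpace ℝ (Fin 3) := barlowPos 1 (Real.sqrt (2 / 3)) constHagg 0 1 0 with hu
  set v : EuclideanSpace ℝ (Fin 3) := barlowPos 1 (Real.sqrt (2 / 3)) constHagg 0 0 1 with hv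
  set t : EuclideanSpace ℝ (Fin 3) := barlowPos 1 (Real.sqrt (2 / 3)) constHagg 1 0 0 with ht
  set E₁ : Fin 3 → EuclideanSpace ℝ (Fin 3) := ![u, v, v - t] with hE₁
  set E₂ : Fin 3 → EuclideanSpace ℝ (Fin 3) := ![t, u - t, u - v] with hE₂
  -- positions from chart coordinates
  have hpos₁ : ∀ c : Site 3, (∑ l, ((c l : ℤ) : ℝ) • E₁ l) =
      barlowPos 1 (Real.sqrt (2 / 3)) constHagg (-c 2) (c 0) (c 1 + c 2) := by
    intro c
    rw [barlowPos_fcc_chart₁, Fin.sum_univ_three]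
    simp only [hE₁, Matrix.cons_val_zero, Matrix.cons_val_one, Matrix.cons_val, hu, hv, ht]
    push_cast; module
  have hpos₂ : ∀ c : Site 3, (∑ l, ((c l : ℤ) : ℝ) • E₂ l) =
      barlowPos 1 (Real.sqrt (2 / 3)) constHagg (c 0 - c 1) (c 1 + c 2) (-c 2) := by
    intro c
    rw [barlowPos_fcc_chart₂, Fin.sum_univ_three]
    simp only [hE₂, Matrix.cons_val_zero, Matrix.cons_val_one, Matrix.cons_val, hu, hv, ht]
    push_cast; module
  -- a lattice site of `K` is some `y i`, with matching coordinates
  have key : ∀ k i j : ℤ, barlowPos 1 (Real.sqrt (2 / 3)) constHagg k i j ∈ K →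
      ∃ i₀, kg i₀ = k ∧ pg i₀ = i ∧ qg i₀ = j := by
    intro k i j hk
    have hp : barlowPos 1 (Real.sqrt (2 / 3)) constHagg k i j ∈ P := (hP _).2 ⟨barlowPos_mem _ _ _, hk⟩
    rw [← hyim, mem_image] at hp
    obtain ⟨i₀, -, hi₀⟩ := hp
    rw [hcy i₀] at hi₀
    have hh := barlowPos_fcc_injective hi₀
    simp only [Prod.mk.injEq] at hh
    exact ⟨i₀, hh.1, hh.2.1, hh.2.2⟩
  have hyK : ∀ i, y i ∈ K := fun i => by
    have : y i ∈ P := by rw [← hyim]; exact mem_image_of_mem _ (mem_univ _)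
    exact ((hP _).1 this).2
  -- line-convexity of the two chart images of `P`
  have hconv₁ : ∀ d : Fin 3, ∀ s₁ ∈ univ.image b₁, ∀ s₂ ∈ univ.image b₁,
      Fin.removeNth d s₁ = Fin.removeNth d s₂ → ∀ z : Site 3,
      Fin.removeNth d z = Fin.removeNth d s₁ → s₁ d ≤ z d → z d ≤ s₂ d → z ∈ univ.image b₁ := by
    intro d s₁ hs₁ s₂ hs₂ h12 z hz hz1 hz2
    rw [mem_image] at hs₁ hs₂
    obtain ⟨i₁, -, rfl⟩ := hs₁
    obtain ⟨i₂, -, rfl⟩ := hs₂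
    have hy₁ : y i₁ = ∑ l, ((b₁ i₁ l : ℤ) : ℝ) • E₁ l := by
      rw [hpos₁, hcy i₁]; congr 1 <;> simp [hb₁]
    have hy₂ : y i₂ = ∑ l, ((b₁ i₂ l : ℤ) : ℝ) • E₁ l := by
      rw [hpos₁, hcy i₂]; congr 1 <;> simp [hb₁]
    -- the point with chart coordinates `z` lies on the segment `[y i₁, y i₂]`
    have hzpos := frame_sub_of_removeNth_eq E₁ d (b₁ i₁) z hz
    have h2pos := frame_sub_of_removeNth_eq E₁ d (b₁ i₁) (b₁ i₂) h12.symm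
    have hmemK : (∑ l, ((z l : ℤ) : ℝ) • E₁ l) ∈ K := by
      rcases eq_or_lt_of_le (hz1.trans hz2) with heq | hlt
      · -- degenerate: s₁ d = s₂ d forces z = s₁
        have hzd : z d = b₁ i₁ d := le_antisymm (heq ▸ hz2) hz1
        rw [hzpos, hzd, sub_self, Int.cast_zero, zero_smul, add_zero, ← hy₁]; exact hyK i₁
      · set θ : ℝ := ((z d - b₁ i₁ d : ℤ) : ℝ) / ((b₁ i₂ d - b₁ i₁ d : ℤ) : ℝ) with hθ
        have hden : (0 : ℝ) < ((b₁ i₂ d - b₁ i₁ d : ℤ) : ℝ) := by exact_mod_cast (by omega)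
        have hθ01 : θ ∈ Set.Icc (0 : ℝ) 1 := by
          refine ⟨div_nonneg (by exact_mod_cast (by omega)) hden.le, ?_⟩
          rw [div_le_one hden]; exact_mod_cast (by omega)
        have hseg := hK.add_smul_sub_mem (hyK i₁) (hyK i₂) hθ01
        have e : y i₁ + θ • (y i₂ - y i₁) = ∑ l, ((z l : ℤ) : ℝ) • E₁ l := by
          rw [hzpos, hy₁, hy₂, h2pos, add_sub_cancel_left, smul_smul, hθ, div_mul_cancel₀ _ hden.ne']
        rw [← e]; exact hseg
    rw [hpos₁] at hmemK
    obtain ⟨i₀, hk, hp, hq⟩ := key _ _ _ hmemK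
    rw [mem_image]
    refine ⟨i₀, mem_univ _, ?_⟩
    ext l; fin_cases l <;> simp [hb₁, hk, hp, hq]
  have hconv₂ : ∀ d : Fin 3, ∀ s₁ ∈ univ.image b₂, ∀ s₂ ∈ univ.image b₂,
      Fin.removeNth d s₁ = Fin.removeNth d s₂ → ∀ z : Site 3,
      Fin.removeNth d z = Fin.removeNth d s₁ → s₁ d ≤ z d → z d ≤ s₂ d → z ∈ univ.image b₂ := by
    intro d s₁ hs₁ s₂ hs₂ h12 z hz hz1 hz2
    rw [mem_image] at hs₁ hs₂
    obtain ⟨i₁, -, rfl⟩ := hs₁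
    obtain ⟨i₂, -, rfl⟩ := hs₂
    have hy₁ : y i₁ = ∑ l, ((b₂ i₁ l : ℤ) : ℝ) • E₂ l := by
      rw [hpos₂, hcy i₁]; congr 1 <;> simp [hb₂]
    have hy₂ : y i₂ = ∑ l, ((b₂ i₂ l : ℤ) : ℝ) • E₂ l := by
      rw [hpos₂, hcy i₂]; congr 1 <;> simp [hb₂]
    have hzpos := frame_sub_of_removeNth_eq E₂ d (b₂ i₁) z hz
    have h2pos := frame_sub_of_removeNth_eq E₂ d (b₂ i₁) (b₂ i₂) h12.symm
    have hmemK : (∑ l, ((z l : ℤ) : ℝ) • E₂ l) ∈ K := by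
      rcases eq_or_lt_of_le (hz1.trans hz2) with heq | hlt
      · have hzd : z d = b₂ i₁ d := le_antisymm (heq ▸ hz2) hz1
        rw [hzpos, hzd, sub_self, Int.cast_zero, zero_smul, add_zero, ← hy₁]; exact hyK i₁
      · set θ : ℝ := ((z d - b₂ i₁ d : ℤ) : ℝ) / ((b₂ i₂ d - b₂ i₁ d : ℤ) : ℝ) with hθ
        have hden : (0 : ℝ) < ((b₂ i₂ d - b₂ i₁ d : ℤ) : ℝ) := by exact_mod_cast (by omega)
        have hθ01 : θ ∈ Set.Icc (0 : ℝ) 1 := by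
          refine ⟨div_nonneg (by exact_mod_cast (by omega)) hden.le, ?_⟩
          rw [div_le_one hden]; exact_mod_cast (by omega)
        have hseg := hK.add_smul_sub_mem (hyK i₁) (hyK i₂) hθ01
        have e : y i₁ + θ • (y i₂ - y i₁) = ∑ l, ((z l : ℤ) : ℝ) • E₂ l := by
          rw [hzpos, hy₁, hy₂, h2pos, add_sub_cancel_left, smul_smul, hθ, div_mul_cancel₀ _ hden.ne']
        rw [← e]; exact hseg
    rw [hpos₂] at hmemK
    obtain ⟨i₀, hk, hp, hq⟩ := key _ _ _ hmemK
    rw [mem_image]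
    refine ⟨i₀, mem_univ _, ?_⟩
    ext l; fin_cases l <;> simp [hb₂, hk, hp, hq]
    omega
  have hbp₁ := card_boundaryPairs_eq_two_mul_sum_card_dropCoord (univ.image b₁) hconv₁
  have hbp₂ := card_boundaryPairs_eq_two_mul_sum_card_dropCoord (univ.image b₂) hconv₂
  -- monotonicity of the shadows: chart images of `P` sit inside those of `X`
  have hsub : ∀ i : Fin M, ∃ j : Fin N, kf j = kg i ∧ pf j = pg i ∧ qf j = qg i := by
    intro i
    have : y i ∈ X := hPX (by rw [← hyim]; exact mem_image_of_mem _ (mem_univ _))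
    rw [← hxim, mem_image] at this
    obtain ⟨j, -, hj⟩ := this
    rw [hcx j, hcy i] at hj
    have hh := barlowPos_fcc_injective hj
    simp only [Prod.mk.injEq] at hh
    exact ⟨j, hh.1, hh.2.1, hh.2.2⟩
  have hmono₁ : univ.image b₁ ⊆ univ.image a₁ := by
    intro s hs
    rw [mem_image] at hs ⊢
    obtain ⟨i, -, rfl⟩ := hs
    obtain ⟨j, h1, h2, h3⟩ := hsub i; exact ⟨j, mem_univ _, by simp [ha₁, hb₁, h1, h2, h3]⟩
  have hmono₂ : univ.image b₂ ⊆ univ.image a₂ := by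
    intro s hs
    rw [mem_image] at hs ⊢
    obtain ⟨i, -, rfl⟩ := hs
    obtain ⟨j, h1, h2, h3⟩ := hsub i; exact ⟨j, mem_univ _, by simp [ha₂, hb₂, h1, h2, h3]⟩
  have hdc : ∀ (d : Fin 3) (A B : Finset (Site 3)), A ⊆ B →
      (dropCoord d A).card ≤ (dropCoord d B).card := fun d A B hAB =>
    card_le_card (image_subset_image hAB)
  have hsum₁ : ∑ d : Fin 3, (dropCoord d (univ.image b₁)).card ≤
      ∑ d : Fin 3, (dropCoord d (univ.image a₁)).card :=
    sum_le_sum fun d _ => hdc d _ _ hmono₁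
  have hsum₂ : ∑ d : Fin 3, (dropCoord d (univ.image b₂)).card ≤
      ∑ d : Fin 3, (dropCoord d (univ.image a₂)).card :=
    sum_le_sum fun d _ => hdc d _ _ hmono₂
  -- assemble
  have h1 : ((boundaryPairs (univ.image b₁)).card : ℝ) =
      2 * ((∑ d : Fin 3, (dropCoord d (univ.image b₁)).card : ℕ) : ℝ) := by exact_mod_cast hbp₁
  have h2 : ((boundaryPairs (univ.image b₂)).card : ℝ) =
      2 * ((∑ d : Fin 3, (dropCoord d (univ.image b₂)).card : ℕ) : ℝ) := by exact_mod_cast hbp₂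
  have h3 : ((∑ d : Fin 3, (dropCoord d (univ.image b₁)).card : ℕ) : ℝ) ≤
      ((∑ d : Fin 3, (dropCoord d (univ.image a₁)).card : ℕ) : ℝ) := by exact_mod_cast hsum₁
  have h4 : ((∑ d : Fin 3, (dropCoord d (univ.image b₂)).card : ℕ) : ℝ) ≤
      ((∑ d : Fin 3, (dropCoord d (univ.image a₂)).card : ℕ) : ℝ) := by exact_mod_cast hsum₂
  rw [hDX, hDP, hhalf]
  simp only [hb₁, hb₂, ha₁, ha₂] at h1 h2 h3 h4 hshadow' ⊢
  linarith

/-- **Lattice rung of the adhesion atom** («adhesion ≤ cohesive deficiency», constant `0`): for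
`X ⊆ Λ₀` finite and `P = Λ₀ ∩ K ⊆ X` with `K` convex,
`#{(p, q) ∈ P × (X \ P) : dist p q = 1} ≤ contactDeficiency (X \ P)`. -/
theorem cross_le_contactDeficiency_of_convex_sample (X P : Finset (EuclideanSpace ℝ (Fin 3)))
    (K : Set (EuclideanSpace ℝ (Fin 3))) (hK : Convex ℝ K)
    (hX : (↑X : Set (EuclideanSpace ℝ (Fin 3))) ⊆ fccStacking 1 (Real.sqrt (2 / 3)))
    (hPX : P ⊆ X) (hP : ∀ p, p ∈ P ↔ (p ∈ fccStacking 1 (Real.sqrt (2 / 3)) ∧ p ∈ K)) :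
    ((((P ×ˢ (X \ P)).filter fun pq => dist pq.1 pq.2 = 1).card : ℕ) : ℝ) ≤
      contactDeficiency (X \ P) := by
  linarith [contactDeficiency_le_of_convex_sample X P K hK hX hPX hP, contactDeficiency_sdiff_split hPX]

/-- The slab sample region `{p : −2R ≤ ⟪p,ν⟫ ≤ −R, ‖p‖² − ⟪p,ν⟫² ≤ ρ²}` is convex
(`‖ν‖ = 1`, `ρ ≥ 0`): two half-spaces and a cylinder about the axis `ℝν`. -/
theorem convex_slabSampleRegion (ν : EuclideanSpace ℝ (Fin 3)) (hν : ‖ν‖ = 1) (R ρ : ℝ)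
    (hρ : 0 ≤ ρ) :
    Convex ℝ {p : EuclideanSpace ℝ (Fin 3) | -(2 * R) ≤ ⟪p, ν⟫_ℝ ∧ ⟪p, ν⟫_ℝ ≤ -R ∧
      ‖p‖ ^ 2 - ⟪p, ν⟫_ℝ ^ 2 ≤ ρ ^ 2} := by
  intro p hp q hq a b ha hb hab
  simp only [Set.mem_setOf_eq] at hp hq ⊢
  obtain ⟨hp1, hp2, hp3⟩ := hp
  obtain ⟨hq1, hq2, hq3⟩ := hq
  have hin : ⟪a • p + b • q, ν⟫_ℝ = a * ⟪p, ν⟫_ℝ + b * ⟪q, ν⟫_ℝ := by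
    rw [inner_add_left, inner_smul_left, inner_smul_left]; simp
  refine ⟨by rw [hin]; nlinarith, by rw [hin]; nlinarith, ?_⟩
  -- the lateral part `p − ⟪p,ν⟫ν` is linear in `p` and its norm is convex
  have hlat : ∀ r : EuclideanSpace ℝ (Fin 3), ‖r‖ ^ 2 - ⟪r, ν⟫_ℝ ^ 2 = ‖r - ⟪r, ν⟫_ℝ • ν‖ ^ 2 :=
    fun r => (norm_sub_inner_smul_sq ν r hν).symm
  rw [hlat] at hp3 hq3 ⊢
  have hp4 : ‖p - ⟪p, ν⟫_ℝ • ν‖ ≤ ρ := (sq_le_sq₀ (norm_nonneg _) hρ).1 hp3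
  have hq4 : ‖q - ⟪q, ν⟫_ℝ • ν‖ ≤ ρ := (sq_le_sq₀ (norm_nonneg _) hρ).1 hq3
  have e : a • p + b • q - ⟪a • p + b • q, ν⟫_ℝ • ν =
      a • (p - ⟪p, ν⟫_ℝ • ν) + b • (q - ⟪q, ν⟫_ℝ • ν) := by
    rw [hin, smul_sub, smul_sub, smul_smul, smul_smul, add_smul]
    abel
  have hle : ‖a • p + b • q - ⟪a • p + b • q, ν⟫_ℝ • ν‖ ≤ ρ := by
    rw [e]
    calc ‖a • (p - ⟪p, ν⟫_ℝ • ν) + b • (q - ⟪q, ν⟫_ℝ • ν)‖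
        ≤ ‖a • (p - ⟪p, ν⟫_ℝ • ν)‖ + ‖b • (q - ⟪q, ν⟫_ℝ • ν)‖ := norm_add_le _ _
      _ = a * ‖p - ⟪p, ν⟫_ℝ • ν‖ + b * ‖q - ⟪q, ν⟫_ℝ • ν‖ := by
          rw [norm_smul, norm_smul, Real.norm_eq_abs, Real.norm_eq_abs, abs_of_nonneg ha,
            abs_of_nonneg hb]
      _ ≤ a * ρ + b * ρ := by gcongr
      _ = ρ := by rw [← add_mul, hab, one_mul]
  exact (sq_le_sq₀ (norm_nonneg _) hρ).2 hle

/-- **`LatticeNoGain` at every normal.**  For every `R ≥ 1` there is `C` (`= 60 √2 π`) such that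
for EVERY unit normal `ν`, every `ρ ≥ R` and every finite `X ⊆ Λ₀ = fccStacking 1 √(2/3)`
containing the slab sample `{p ∈ Λ₀ : −2R ≤ ⟪p,ν⟫ ≤ −R, ‖p‖² − ⟪p,ν⟫² ≤ ρ²}`:
`D(X) ≥ 2 φ(ν) π ρ² − C ρ` with the crux's inlined `φ`.  (No lattice continuation of the sample —
bulk, steps, kinks, islands, anything on `Λ₀` — lowers the deficiency below the two flat faces.) -/
theorem latticeNoGain :
    ∀ R : ℝ, 1 ≤ R → ∃ C : ℝ, ∀ ν : EuclideanSpace ℝ (Fin 3), ‖ν‖ = 1 → ∀ ρ : ℝ, R ≤ ρ →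
      ∀ X : Finset (EuclideanSpace ℝ (Fin 3)),
        (↑X : Set (EuclideanSpace ℝ (Fin 3))) ⊆ fccStacking 1 (Real.sqrt (2 / 3)) →
        (∀ p ∈ fccStacking 1 (Real.sqrt (2 / 3)), -(2 * R) ≤ ⟪p, ν⟫_ℝ → ⟪p, ν⟫_ℝ ≤ -R →
          ‖p‖ ^ 2 - ⟪p, ν⟫_ℝ ^ 2 ≤ ρ ^ 2 → p ∈ X) →
        2 * (Real.sqrt 2 / 4 * ∑ᶠ w ∈ {w ∈ fccStacking 1 (Real.sqrt (2 / 3)) | ‖w‖ = 1},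
            |⟪w, ν⟫_ℝ|) * Real.pi * ρ ^ 2 - C * ρ ≤ contactDeficiency X := by
  classical
  intro R hR
  obtain ⟨C, hC⟩ := stub_sampleDeficit R hR
  refine ⟨C, fun ν hν ρ hρ X hX hS => ?_⟩
  set K : Set (EuclideanSpace ℝ (Fin 3)) := {p | -(2 * R) ≤ ⟪p, ν⟫_ℝ ∧ ⟪p, ν⟫_ℝ ≤ -R ∧
      ‖p‖ ^ 2 - ⟪p, ν⟫_ℝ ^ 2 ≤ ρ ^ 2} with hKdef
  set P : Finset (EuclideanSpace ℝ (Fin 3)) := X.filter fun p =>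
    p ∈ fccStacking 1 (Real.sqrt (2 / 3)) ∧ -(2 * R) ≤ ⟪p, ν⟫_ℝ ∧ ⟪p, ν⟫_ℝ ≤ -R ∧
      ‖p‖ ^ 2 - ⟪p, ν⟫_ℝ ^ 2 ≤ ρ ^ 2 with hPdef
  have hPiff : ∀ p, p ∈ P ↔ (p ∈ fccStacking 1 (Real.sqrt (2 / 3)) ∧ -(2 * R) ≤ ⟪p, ν⟫_ℝ ∧
      ⟪p, ν⟫_ℝ ≤ -R ∧ ‖p‖ ^ 2 - ⟪p, ν⟫_ℝ ^ 2 ≤ ρ ^ 2) := by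
    intro p
    rw [hPdef, Finset.mem_filter]
    exact ⟨fun h => h.2, fun h => ⟨hS p h.1 h.2.1 h.2.2.1 h.2.2.2, h⟩⟩
  have hPiff' : ∀ p, p ∈ P ↔ (p ∈ fccStacking 1 (Real.sqrt (2 / 3)) ∧ p ∈ K) := by
    intro p; rw [hPiff p]; simp only [hKdef, Set.mem_setOf_eq]
  have hK : Convex ℝ K := convex_slabSampleRegion ν hν R ρ (by linarith)
  linarith [hC ν hν ρ hρ P hPiff,
    contactDeficiency_le_of_convex_sample X P K hK hX (Finset.filter_subset _ _) hPiff']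

end Summit.Ventures.Crystal3D.Theorems

end
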